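import Summits.ResolutionOfSingularities.ResolutionOfSingularities.Theorems.FrobeniusLadderFRationalResolutionStubRungsOfSummit
import Literature.RingTheory.TightClosure.FRationalNormal
import Mathlib.AlgebraicGeometry.Noetherian
import Mathlib.AlgebraicGeometry.Morphisms.FiniteType
import HarnessLib

/-!
# The F-rational models of route `FrobeniusLadder` are normal schemes

Route `FrobeniusLadder`, cruxes `FRationalModification` (stmt-ResolutionOfSingularities-15316, conclusion)
and `FRationalResolution` (stmt-ResolutionOfSingularities-15317, hypothesis): the model `X' → X` has every
stalk a domain in which every ideal generated by a system of parameters is tightly closed (inline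
clause). By Hochster–Huneke [HochsterHuneke1994, Thm. 4.2 (b)] (tree:
`Literature.RingTheory.TightClosure.isIntegrallyClosed_of_fRational_clause`, proved) such stalks are
integrally closed: `X'` is a NORMAL scheme. This is the first structural fact any line for either crux
uses (singular locus in codimension `≥ 2`; in dimension `2` the cruxes are about normal surfaces).
-/

-- single-problem summit: the doubled namespace component `ResolutionOfSingularities` is forced
set_option linter.dupNamespace false

noncomputable section

open CategoryTheory AlgebraicGeometry TopologicalSpace
open Literature.RingTheory.TightClosure

namespace Summit.ResolutionOfSingularities.ResolutionOfSingularities.Theorems.FRationalResolution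

/-- **F-rational models are normal.** For a scheme `X` locally of finite type over a field `k` of prime
characteristic `p` whose stalks satisfy the F-rational clause of route `FrobeniusLadder` (domain, every
s.o.p. ideal tightly closed, inline form), every stalk `𝒪_{X,x}` is an integrally closed domain
(Hochster–Huneke 1994, Thm. 4.2 (b), via `isIntegrallyClosed_of_fRational_clause`; the stalks are
Noetherian local of characteristic `p`). -/
theorem isIntegrallyClosed_stalk_of_fRational_clause (p : ℕ) (hp : p.Prime) (k : Type) [Field k]
    [CharP k p] (X : Scheme.{0}) (f : X ⟶ Spec (.of k)) [LocallyOfFiniteType f]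
    (hFR : ∀ x : X, IsDomain (X.presheaf.stalk x) ∧ ∀ d : ℕ, ringKrullDim (X.presheaf.stalk x) = d →
      ∀ s : Fin d → X.presheaf.stalk x, (Ideal.span (Set.range s)).radical.IsMaximal →
      ∀ y c : X.presheaf.stalk x, c ≠ 0 →
      (∀ e : ℕ, c * y ^ p ^ e ∈ Ideal.span ((fun z : X.presheaf.stalk x => z ^ p ^ e) ''
        (Ideal.span (Set.range s) : Set (X.presheaf.stalk x)))) → y ∈ Ideal.span (Set.range s))
    (x : X) : IsIntegrallyClosed (X.presheaf.stalk x) := by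
  haveI : Fact p.Prime := ⟨hp⟩
  haveI : IsLocallyNoetherian X := LocallyOfFiniteType.isLocallyNoetherian f
  haveI : IsDomain (X.presheaf.stalk x) := (hFR x).1
  haveI : CharP (X.presheaf.stalk x) p := RungsOfSummit.charP_stalk_of_over hp.ne_zero k f x
  exact isIntegrallyClosed_of_fRational_clause p (hFR x).2

end Summit.ResolutionOfSingularities.ResolutionOfSingularities.Theorems.FRationalResolution

end
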